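import Literature.Barriers.CriticalPhenomena.RigorousRGSmallParameterTestFunctionNorm
import Mathlib.Data.Nat.Choose.Sum
import HarnessLib

/-!
# `RigorousRGSmallParameter` (Slade, Theorem 1.4.1): the lattice Leibniz bound for finite-difference
# programmes on products of test functions ([BS-rg-loc] §3.3, towards Lemma 3.3.1)

Companion ("proof architecture") file of
`Literature/Barriers/CriticalPhenomena/RigorousRGSmallParameter.lean` (Loc norm-estimates layer,
[BS-rg-loc] Propositions 1.4.5–1.4.6, behind the contraction of `K` in Slade's Theorem 6.3.1).
[BS-rg-loc] Lemma 3.3.1 bounds the localised norm `‖g‖_{Φ(X)} ≤ ‖gχ_t‖_Φ` of a test function by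
its derivatives on `X_{2t}`, multiplying `g` by a lattice cutoff `χ_t` and distributing the finite
differences of the `Φ`-norm over the two factors. This file PROVES the abstract distribution step —
the iterated lattice Leibniz rule `∇(fg) = (∇f)(τg) + f(∇g)` as a BOUND, with (a) a per-slot budget
of differences (admissibility is inherited by both factors) and (b) a growing family of regions
(each unit shift `τ` moves the evaluation point by one step, so bounds for `f, g` are required on
the `|β|`-th enlargement of the region of `z`):

* `shiftAt_comm`, `shiftOp`, `napply_shiftOp` (`∇^β τ = τ ∇^β`), **`diffOp_mul`**, `napply_add'`,
  `napply_append_singleton`;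
* `RegionSys` (monotone regions stable under one shift up to index `+1`), `DerivBd`
  (`|∇^γ f_z| ≤ F r |γ|` on `P r` within budget `b`), `DerivBd.mono_budget`, `lowerAt`,
  `countAt_singleton`, `countAt_append_singleton_le`, `derivBd_diffOp`, `derivBd_shiftOp`;
* `leibnizBd F G r n = Σ_{i+j=n} C(n,i) F(r+n,i) G(r+n,j)` and **`abs_napply_mul_le`**:
  `|∇^β(fg)_z| ≤ leibnizBd F G r |β|` for `z ∈ P r`, `β` within budget (Pascal recursion via
  `Finset.sum_antidiagonal_choose_succ_mul`).

Sources: D. C. Brydges, G. Slade, *A renormalisation group method. II. Approximation by local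
polynomials*, J. Stat. Phys. 159 (2015) 461–491, arXiv:1403.7253, §3.3 (Lemma 3.3.1 and its
proof), TeX-source numbering.

## References

* [BrydgesSlade2015RGII] D. C. Brydges, G. Slade, *A renormalisation group method. II.
  Approximation by local polynomials*, J. Stat. Phys. **159** (2015) 461–491, arXiv:1403.7253.
-/

noncomputable section

namespace Literature.Barriers.CriticalPhenomena

namespace LongRangePhi4

namespace Tphi

open Finset

section Leibniz

variable {Λ : Type*} [AddCommGroup Λ] {ι : Type*} {S : Type*} (step : S → Λ)

/-- Shifts at (possibly equal) slots commute. [folklore] -/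
theorem shiftAt_comm (k k' : ℕ) (s s' : Λ) (z : List (Λ × ι)) :
    shiftAt k s (shiftAt k' s' z) = shiftAt k' s' (shiftAt k s z) := by
  unfold shiftAt
  apply List.ext_getElem
  · simp
  · intro i h1 h2
    simp only [List.getElem_modify]
    split_ifs with ha hb
    · subst ha; simp only; rw [add_right_comm]
    · rfl
    · rfl
    · rfl

/-- The shift (translation) operator `(τ_{k,s} g)_z = g_{shift_k^s z}`. [folklore] -/
def shiftOp (k : ℕ) (s : Λ) (g : List (Λ × ι) → ℝ) : List (Λ × ι) → ℝ := fun z => g (shiftAt k s z)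

/-- `∇^β` commutes with shifts. [folklore] -/
theorem napply_shiftOp (k : ℕ) (s : Λ) : ∀ (β : List (ℕ × S)) (g : List (Λ × ι) → ℝ),
    napply step β (shiftOp k s g) = shiftOp k s (napply step β g)
  | [], g => rfl
  | q :: β, g => by
      rw [napply_cons, napply_cons, napply_shiftOp k s β g]
      funext z
      simp only [diffOp, shiftOp, shiftAt_comm q.1 k (step q.2) s z]

/-- **The one-step lattice Leibniz rule** `∇(fg) = (∇f)(τg) + f(∇g)`. [folklore] -/
theorem diffOp_mul (k : ℕ) (s : Λ) (f g : List (Λ × ι) → ℝ) :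
    diffOp k s (fun z => f z * g z) = fun z => diffOp k s f z * shiftOp k s g z + f z * diffOp k s g z := by
  funext z
  simp only [diffOp, shiftOp]
  ring

/-- `∇^α` is additive (pointwise-lambda form). [folklore] -/
theorem napply_add' (α : List (ℕ × S)) (g g' : List (Λ × ι) → ℝ) :
    napply step α (fun z => g z + g' z) = napply step α g + napply step α g' :=
  napply_add step α g g'

/-- `∇^{β ∘ q} h = ∇^β(∇_q h)` (the innermost difference first). [folklore] -/
theorem napply_append_singleton (β : List (ℕ × S)) (q : ℕ × S) (h : List (Λ × ι) → ℝ) :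
    napply step (β ++ [q]) h = napply step β (diffOp q.1 (step q.2) h) := by
  rw [napply_append]; rfl

/-- A **region system**: predicates `P r` on sequences, increasing in `r`, with one unit shift
moving `P r` into `P (r+1)`. [folklore] -/
structure RegionSys (P : ℕ → List (Λ × ι) → Prop) : Prop where
  mono : ∀ r z, P r z → P (r + 1) z
  shift : ∀ r z (k : ℕ) (s : S), P r z → P (r + 1) (shiftAt k (step s) z)

/-- `P r z → P (r + m) z`. [folklore] -/
theorem RegionSys.mono_add {P : ℕ → List (Λ × ι) → Prop} (hP : RegionSys step P) {r : ℕ} {z : List (Λ × ι)}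
    (h : P r z) : ∀ m, P (r + m) z
  | 0 => h
  | m + 1 => hP.mono _ _ (hP.mono_add h m)

/-- **Derivative bounds on a region system**: `|∇^γ f_z| ≤ F r |γ|` for `z ∈ P r` and every
programme `γ` within the per-slot budget `b`. [folklore] -/
def DerivBd (P : ℕ → List (Λ × ι) → Prop) (b : ℕ → ℕ) (F : ℕ → ℕ → ℝ) (f : List (Λ × ι) → ℝ) : Prop :=
  ∀ (r : ℕ) (γ : List (ℕ × S)) (z : List (Λ × ι)), (∀ p, countAt p γ ≤ b p) → P r z → |napply step γ f z| ≤ F r γ.length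

/-- Lowering the budget preserves derivative bounds. [folklore] -/
theorem DerivBd.mono_budget {P : ℕ → List (Λ × ι) → Prop} {b b' : ℕ → ℕ} (hbb : ∀ p, b' p ≤ b p) {F : ℕ → ℕ → ℝ}
    {f : List (Λ × ι) → ℝ} (h : DerivBd step P b F f) : DerivBd step P b' F f :=
  fun r γ z hγ hz => h r γ z (fun p => (hγ p).trans (hbb p)) hz

/-- The budget with one unit removed at slot `k`. [folklore] -/
def lowerAt (b : ℕ → ℕ) (k : ℕ) : ℕ → ℕ := fun p => if p = k then b p - 1 else b p

/-- `lowerAt b k ≤ b`. [folklore] -/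
theorem lowerAt_le (b : ℕ → ℕ) (k p : ℕ) : lowerAt b k p ≤ b p := by
  unfold lowerAt; split_ifs <;> omega

/-- `countAt` of a one-difference programme. [folklore] -/
theorem countAt_singleton (p k : ℕ) (s : S) : countAt p [(k, s)] = if p = k then 1 else 0 := by
  unfold countAt
  by_cases h : p = k
  · subst h; simp
  · rw [if_neg h]; simp [List.count_eq_zero, h]

/-- Appending the removed difference restores the budget. [folklore] -/
theorem countAt_append_singleton_le {b : ℕ → ℕ} {k : ℕ} (hk : 1 ≤ b k) {γ : List (ℕ × S)}
    (hγ : ∀ p, countAt p γ ≤ lowerAt b k p) (s : S) (p : ℕ) : countAt p (γ ++ [(k, s)]) ≤ b p := by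
  rw [countAt_append, countAt_singleton]
  have h := hγ p
  unfold lowerAt at h
  by_cases hp : p = k
  · subst hp; rw [if_pos rfl] at h ⊢; omega
  · rw [if_neg hp] at h ⊢; omega

/-- **Bounds for `∇_q f` under the lowered budget.** [folklore] -/
theorem derivBd_diffOp {P : ℕ → List (Λ × ι) → Prop} {b : ℕ → ℕ} {k : ℕ} (hk : 1 ≤ b k) (s : S)
    {F : ℕ → ℕ → ℝ} {f : List (Λ × ι) → ℝ} (h : DerivBd step P b F f) :
    DerivBd step P (lowerAt b k) (fun r i => F r (i + 1)) (diffOp k (step s) f) := by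
  intro r γ z hγ hz
  have e : napply step γ (diffOp k (step s) f) = napply step (γ ++ [(k, s)]) f := (napply_append_singleton step γ (k, s) f).symm
  rw [e]
  have h1 := h r (γ ++ [(k, s)]) z (countAt_append_singleton_le hk hγ s) hz
  simpa using h1

/-- **Bounds for `τ_q g`** (one region up). [folklore] -/
theorem derivBd_shiftOp {P : ℕ → List (Λ × ι) → Prop} (hP : RegionSys step P) {b : ℕ → ℕ} (k : ℕ) (s : S)
    {G : ℕ → ℕ → ℝ} {g : List (Λ × ι) → ℝ} (h : DerivBd step P b G g) :
    DerivBd step P b (fun r i => G (r + 1) i) (shiftOp k (step s) g) := by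
  intro r γ z hγ hz
  rw [napply_shiftOp]
  exact h (r + 1) γ _ hγ (hP.shift r z k s hz)

/-- The Leibniz bound: `Σ_{i+j=n} C(n,i) F(r+n, i) G(r+n, j)`. [folklore] -/
def leibnizBd (F G : ℕ → ℕ → ℝ) (r n : ℕ) : ℝ :=
  ∑ ij ∈ antidiagonal n, ((n.choose ij.1 : ℕ) : ℝ) * (F (r + n) ij.1 * G (r + n) ij.2)

/-- **The lattice Leibniz bound.** If `|∇^γ f_z| ≤ F r |γ|` and `|∇^γ g_z| ≤ G r |γ|` on the
regions `P r` for all programmes within the per-slot budget `b` (`F, G ≥ 0` and increasing in the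
region index), then for every programme `β` within the budget and `z ∈ P r`,
`|∇^β(fg)_z| ≤ Σ_{i+j=|β|} C(|β|,i) F(r+|β|, i) G(r+|β|, j)`. [cite: BrydgesSlade2015RGII, §3.3 (proof of Lemma 3.3.1, estimate of ‖gχ_t‖_Φ)] -/
theorem abs_napply_mul_le {P : ℕ → List (Λ × ι) → Prop} (hP : RegionSys step P) :
    ∀ (β : List (ℕ × S)) (b : ℕ → ℕ) (F G : ℕ → ℕ → ℝ) (f g : List (Λ × ι) → ℝ),
      (∀ p, countAt p β ≤ b p) → (∀ r i, 0 ≤ F r i) → (∀ r i, 0 ≤ G r i) →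
      (∀ r r' i, r ≤ r' → F r i ≤ F r' i) → (∀ r r' i, r ≤ r' → G r i ≤ G r' i) →
      DerivBd step P b F f → DerivBd step P b G g →
      ∀ (r : ℕ) (z : List (Λ × ι)), P r z → |napply step β (fun w => f w * g w) z| ≤ leibnizBd F G r β.length := by
  intro β
  induction β using List.reverseRecOn with
  | nil =>
      intro b F G f g _ hF0 hG0 _ _ hf hg r z hz
      simp only [napply_nil, leibnizBd, List.length_nil, Finset.Nat.antidiagonal_zero, Finset.sum_singleton,
        Nat.choose_zero_right, Nat.cast_one, one_mul, add_zero, abs_mul]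
      have h1 := hf r [] z (fun p => by simp [countAt]) hz
      have h2 := hg r [] z (fun p => by simp [countAt]) hz
      simp only [napply_nil, List.length_nil] at h1 h2
      exact mul_le_mul h1 h2 (abs_nonneg _) (hF0 _ _)
  | append_singleton β q ih =>
      intro b F G f g hβ hF0 hG0 hFm hGm hf hg r z hz
      obtain ⟨k, s⟩ := q
      -- the budget at slot `k` is positive
      have hk : 1 ≤ b k := by
        have h := hβ k
        rw [countAt_append, countAt_singleton, if_pos rfl] at h
        omega
      have hβ' : ∀ p, countAt p β ≤ lowerAt b k p := by
        intro p
        have h := hβ p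
        rw [countAt_append, countAt_singleton] at h
        unfold lowerAt
        by_cases hp : p = k
        · subst hp; rw [if_pos rfl] at h ⊢; omega
        · rw [if_neg hp] at h ⊢; omega
      rw [napply_append_singleton, diffOp_mul, napply_add', Pi.add_apply]
      -- term 1: `(∇_q f)(τ_q g)`; term 2: `f (∇_q g)`
      have hf1 := derivBd_diffOp step hk s hf
      have hg1 := (derivBd_shiftOp step hP k s hg).mono_budget step (lowerAt_le b k)
      have hf2 := hf.mono_budget step (lowerAt_le b k)
      have hg2 : DerivBd step P (lowerAt b k) (fun r i => G r (i + 1)) (diffOp k (step s) g) := derivBd_diffOp step hk s hg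
      have t1 := ih (lowerAt b k) (fun r i => F r (i + 1)) (fun r i => G (r + 1) i) _ _ hβ'
        (fun r i => hF0 _ _) (fun r i => hG0 _ _) (fun r r' i h => hFm _ _ _ h) (fun r r' i h => hGm _ _ _ (by omega)) hf1 hg1 r z hz
      have t2 := ih (lowerAt b k) F (fun r i => G r (i + 1)) _ _ hβ'
        hF0 (fun r i => hG0 _ _) hFm (fun r r' i h => hGm _ _ _ h) hf2 hg2 r z hz
      refine (abs_add_le _ _).trans ((add_le_add t1 t2).trans ?_)
      -- Pascal
      simp only [leibnizBd, List.length_append, List.length_singleton]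
      rw [Finset.sum_antidiagonal_choose_succ_mul (fun i j => F (r + (β.length + 1)) i * G (r + (β.length + 1)) j) β.length,
        add_comm]
      refine add_le_add (Finset.sum_le_sum fun ij hij => ?_) (Finset.sum_le_sum fun ij hij => ?_)
      · -- `Σ C(n,i) F i G(j+1)`-part (term 2)
        refine mul_le_mul_of_nonneg_left (mul_le_mul (hFm _ _ _ (by omega)) (hGm _ _ _ (by omega)) (hG0 _ _) (hF0 _ _)) (by positivity)
      · -- `Σ C(n,j) F(i+1) G j`-part (term 1)
        rw [Finset.mem_antidiagonal] at hij
        rw [← Nat.choose_symm_of_eq_add hij.symm]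
        refine mul_le_mul_of_nonneg_left (mul_le_mul (hFm _ _ _ (by omega)) (hGm _ _ _ (by omega)) (hG0 _ _) (hF0 _ _)) (by positivity)

end Leibniz

end Tphi

end LongRangePhi4

end Literature.Barriers.CriticalPhenomena
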